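import Literature.Computation.Certificates.LinearProgramming
import Literature.Computation.Certificates.Data

/-!
# Self-certifying LP bounds: an exact rational two-phase simplex that runs in the kernel (and in `#eval`)

Compute-infrastructure file (unit `infra-psd-sos-lp-checker`, gen 2). `LinearProgramming.lean`
CHECKS dual multipliers supplied by the user (`LP.IsIneqCert`, `IsDualCert`, `IsStdDualCert`,
`IsFarkasCert`); this file COMPUTES them by an exact rational two-phase simplex with Bland's rule
(`LP.Simplex.solve`, plain structural recursion on lists, kernel-evaluable), so that for LITERAL
rational data each of

* `A x ≤ b ⇒ c·x ≤ δ`                 — `LP.SelfIneqCert.sound (fuel := 1000) (by decide +kernel) x hA`,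
* `A x ≤ b, E x = f ⇒ c·x ≤ δ`        — `LP.SelfDualCert.sound (fuel := 1000) (by decide +kernel) x hA hE`,
* `x ≥ 0, A x ≤ b ⇒ c·x ≤ δ`          — `LP.SelfStdCert.sound (fuel := 1000) (by decide +kernel) x hx hA`,
* `A x ≤ b, E x = f ⇒ False`          — `LP.SelfFarkasCert.infeasible (fuel := 1000) (by decide +kernel) x hA hE`,

is closed by ONE `decide +kernel` with no external solver and no multiplier literal in the file
(`δ` is whatever bound the user states; the simplex finds the OPTIMAL multipliers, so the check
passes iff `δ` is at least the LP optimum — `#eval LP.ineqValue A b c 1000` prints that optimum).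
Soundness costs nothing new: the computed multipliers are fed to the TRUSTED predicates of
`LinearProgramming.lean`, whose weak-duality theorems are already proved; the simplex is an
untrusted program — were it wrong, the kernel check would simply fail. The same `LP.Simplex.solve`
serves under `#eval` (compiled, GMP arithmetic) as an exact rational LP solver for problems far
beyond kernel size: it prints the optimal point, which is then pasted as the certificate literal of
`LP.IsIneqCert` & co. (checked by `decide +kernel`, block-wise if needed, or `native_decide`).

## API (namespace `Literature.Computation.Certificates.LP`)

* `LP.Simplex.solve M r c fuel : Result` — `min {c·y : M y = r, y ≥ 0}` for `M` given as a list of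
  rows; `Result = ⟨status ∈ {optimal, infeasible, unbounded, failed}, point, value⟩`; two phases,
  Bland's rule (terminates; `fuel` bounds the number of pivots per phase), artificial variables
  driven out of the basis after phase 1, redundant rows deleted. Helpers `axpy`, `dot`, `mapIdx`,
  `Tableau`, `pivot`, `entering`, `leaving`, `loop`, `initObj`, `driveOut`, `basicPoint`.
* generators: `colsOf`; `ineqDualList A b c fuel` (optimal `y` of `min {b·y : Aᵀy = c, y ≥ 0}`
  as a `List ℚ` — the `#eval` entry point, printing the literal for `vecOfList m […]`),
  `ineqDual` (the same as a `Fin m`-vector, the kernel form), `ineqValue` (the optimum, `#eval`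
  it to learn the best `δ`); likewise `dualPointList` / `dualPairLists` / `dualPair` / `dualValue`
  (`(y, z)` with free `z`), `stdDualList` / `stdDual` / `stdValue` (`min {b·y : Aᵀy ≥ c, y ≥ 0}`),
  `farkasPointList` / `farkasPairLists` / `farkasPair` (minimiser of `b·y + f·z` over
  `yᵀA + zᵀE = 0`, `y ≥ 0`, `∑ y + ∑ |z| = 1`). Never `#eval` the `Fin`-vector forms (printing a
  function re-runs the solver at every index); `#eval` the `…List` forms, and print long ones
  untruncated with `#eval IO.println (toString (LP.ineqDualList A b c 5000))` (plain `#eval`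
  elides long terms with `⋯`); give LARGE input data through `matrixOfRows` / `vecOfList`
  (`Data.lean`), not `!![…]` (the compiler behind `#eval` is very slow on big `!![…]` literals).
* trusted predicates (decidable; each is the corresponding gen-1 predicate applied to the computed
  multipliers) with soundness by delegation: `SelfIneqCert A b c δ fuel` (`.isIneqCert`, `.sound`,
  `.sound_lt`), `SelfDualCert A b E f c δ fuel` (`.isDualCert`, `.sound`, `.sound_lt`),
  `SelfStdCert A b c δ fuel` (`.sound`), `SelfFarkasCert A b E f fuel` (`.infeasible`).
* Kernel-checked tests at the end: the four examples of `LinearProgramming.lean` re-proved WITHOUT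
  certificates, a degenerate / redundant-row case, and `#eval`-style value queries stated as
  `decide`d equations.

## Cost (measured 2026-08-17 on the farm)

A pivot costs `O(p · q)` rational operations on a dense `p × (q + p)` (phase 1) / `p × q` (phase 2)
tableau and Bland's rule typically needs `O(p + q)` pivots. KERNEL (`decide +kernel`, random dense
inequality-form LPs `A x ≤ b` in `n` variables with `m` rows including box rows, so the dual
tableau is `n × (m + n)`): `m × n = 20 × 5` (11 pivots) < 1 s, `40 × 10` (18 pivots) 8 s,
`60 × 15` (42 pivots) 38 s, `80 × 20` (132 pivots) exceeds the kernel memory cap (symptom: "failed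
to reduce to isTrue/isFalse"). `#eval` (interpreted, GMP arithmetic): `80 × 20` in ≈ 2 s,
`120 × 30` (259 pivots, 35-digit optimum) in ≈ 4 s; the printed multipliers are then CHECKED by
`LP.IsIneqCert` & co. with `decide +kernel` at `O(m · n)` cost (thousands of rows are fine there;
§§2–3 of the README). So: kernel self-certification for small LPs (dual tableau up to ≈ `15 × 75`),
`#eval` + check beyond.

## References

Weak duality / Farkas certificates as in G. Blekherman, P. Parrilo, R. Thomas (eds.), *Semidefinite
Optimization and Convex Algebraic Geometry*, SIAM 2012, §2.1.1 (2.3)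
[cite: BlekhermanParriloThomas2012, §2.1.1]; the two-phase tableau simplex with Bland's
anti-cycling rule: R. G. Bland, *New finite pivoting rules for the simplex method*, Math. Oper.
Res. 2 (1977) 103–107, and A. Schrijver, *Theory of Linear and Integer Programming*, Wiley 1986,
§11.2–11.3 [folklore].
-/

namespace Literature.Computation.Certificates

namespace LP

open Finset Matrix

variable {m p n : ℕ}
variable {R : Type*} [Field R] [LinearOrder R] [IsStrictOrderedRing R]

/-! ### The exact simplex on lists (untrusted generator, kernel-evaluable) -/

namespace Simplex

/-- `y + a • x` on coefficient lists. [folklore] -/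
def axpy (a : ℚ) (x y : List ℚ) : List ℚ :=
  List.zipWith (fun xi yi => yi + a * xi) x y

/-- Dot product of coefficient lists. [folklore] -/
def dot (x y : List ℚ) : ℚ :=
  (List.zipWith (· * ·) x y).sum

/-- Index-aware map by structural recursion (the core `List.mapIdx` goes through `Array`).
[folklore] -/
def mapIdx {α β : Type*} (f : ℕ → α → β) : ℕ → List α → List β
  | _, [] => []
  | i, a :: l => f i a :: mapIdx f (i + 1) l

/-- A simplex tableau: constraint rows (coefficients `++ [rhs]`, canonical w.r.t. the basis), the
objective row `[c | 0] − ∑ᵢ c_{B i} · rowᵢ` (reduced costs `++ [−value]`), and the basic column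
of each row. [folklore] -/
structure Tableau where
  /-- constraint rows, each `coefficients ++ [rhs]` -/
  rows : List (List ℚ)
  /-- reduced costs `++ [−(objective value)]` -/
  obj : List ℚ
  /-- basic variable of each row -/
  basis : List ℕ
  deriving Repr

/-- Pivot on row `r`, column `s`. [folklore] -/
def pivot (T : Tableau) (r s : ℕ) : Tableau :=
  let pr := T.rows.getD r []
  let pr' := pr.map (· / pr.getD s 0)
  { rows := mapIdx (fun i ri => if i = r then pr' else axpy (-(ri.getD s 0)) pr' ri) 0 T.rows
    obj := axpy (-(T.obj.getD s 0)) pr' T.obj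
    basis := T.basis.set r s }

/-- Bland's entering rule: the first column index `< q` with negative reduced cost (arguments:
current index, number of columns still allowed, remaining reduced costs). [folklore] -/
def entering : ℕ → ℕ → List ℚ → Option ℕ
  | _, 0, _ => none
  | _, _, [] => none
  | i, q + 1, c :: cs => if c < 0 then some i else entering (i + 1) q cs

/-- Ratio test with Bland's tie-break (smallest basic index): the leaving ROW for entering column
`s`; `rhsIdx` is the position of the right-hand side in a row. [folklore] -/
def leaving (s rhsIdx : ℕ) : ℕ → List (List ℚ) → List ℕ → Option (ℕ × ℚ × ℕ) → Option ℕ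
  | _, [], _, best => best.map fun t => t.1
  | i, row :: rows, bs, best =>
    let a := row.getD s 0
    let b := bs.headD 0
    let best' : Option (ℕ × ℚ × ℕ) :=
      if 0 < a then
        let t := row.getD rhsIdx 0 / a
        match best with
        | none => some (i, t, b)
        | some (i₀, t₀, b₀) =>
          if t < t₀ ∨ (t = t₀ ∧ b < b₀) then some (i, t, b) else some (i₀, t₀, b₀)
      else best
    leaving s rhsIdx (i + 1) rows bs.tail best'

/-- The simplex loop on a canonical tableau with `q` admissible columns: returns the final tableau
and a code `0` = optimal, `1` = unbounded, `2` = out of fuel. [folklore] -/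
def loop (q rhsIdx : ℕ) : ℕ → Tableau → Tableau × ℕ
  | 0, T => (T, 2)
  | fuel + 1, T =>
    match entering 0 q T.obj with
    | none => (T, 0)
    | some s =>
      match leaving s rhsIdx 0 T.rows T.basis none with
      | none => (T, 1)
      | some r => loop q rhsIdx fuel (pivot T r s)

/-- The objective row `[c | 0] − ∑ᵢ c_{B i} · rowᵢ` of a canonical tableau. [folklore] -/
def initObj (c : List ℚ) (rows : List (List ℚ)) (basis : List ℕ) : List ℚ :=
  (List.zip rows basis).foldl (fun acc rb => axpy (-(c.getD rb.2 0)) rb.1 acc) (c ++ [0])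

/-- First index `< q` (from the current index on) holding a nonzero entry. [folklore] -/
def firstNonzeroBelow : ℕ → ℕ → List ℚ → Option ℕ
  | _, 0, _ => none
  | _, _, [] => none
  | i, q + 1, x :: xs => if x = 0 then firstNonzeroBelow (i + 1) q xs else some i

/-- After phase 1: pivot every basic artificial variable (index `≥ q`) out of the basis on some
original column, or delete its row when that row vanishes on the original columns (a redundant
equality). Arguments: fuel, current row, tableau. [folklore] -/
def driveOut (q : ℕ) : ℕ → ℕ → Tableau → Tableau
  | 0, _, T => T
  | fuel + 1, i, T =>
    if T.rows.length ≤ i then T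
    else if T.basis.getD i 0 < q then driveOut q fuel (i + 1) T
    else
      match firstNonzeroBelow 0 q (T.rows.getD i []) with
      | some j => driveOut q fuel (i + 1) (pivot T i j)
      | none => driveOut q fuel i
          { rows := T.rows.eraseIdx i, obj := T.obj, basis := T.basis.eraseIdx i }

/-- The basic solution of a canonical tableau (`q` variables, rhs at `rhsIdx`). [folklore] -/
def basicPoint (q rhsIdx : ℕ) (rows : List (List ℚ)) (basis : List ℕ) : List ℚ :=
  (List.zip rows basis).foldl (fun y rb => y.set rb.2 (rb.1.getD rhsIdx 0)) (List.replicate q 0)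

/-- Outcome of `solve`. [folklore] -/
inductive Status
  | optimal
  | infeasible
  | unbounded
  | failed
  deriving Repr, DecidableEq

/-- Result of `solve`: status, the optimal point (empty unless `optimal`) and the optimal value
(`0` unless `optimal`). [folklore] -/
structure Result where
  /-- outcome -/
  status : Status
  /-- an optimal basic solution (length `q`) when `status = optimal` -/
  point : List ℚ
  /-- the optimal value when `status = optimal` -/
  value : ℚ
  deriving Repr

/-- **Exact two-phase simplex** for `min {c·y : M y = r, y ≥ 0}`, `M` a `p × q` rational matrix
given by its rows (`q = c.length`), Bland's rule in both phases, at most `fuel` pivots per phase.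
[folklore] -/
def solve (M : List (List ℚ)) (r c : List ℚ) (fuel : ℕ) : Result :=
  let p := M.length
  let q := c.length
  -- phase 1 on `[±M | I | ±r]` (signs making the right-hand sides nonnegative)
  let rows₁ := mapIdx (fun i Mi =>
      let s : ℚ := if r.getD i 0 < 0 then -1 else 1
      Mi.map (s * ·) ++ ((List.range p).map fun k => if k = i then (1 : ℚ) else 0) ++
        [s * r.getD i 0]) 0 M
  let basis₁ := (List.range p).map (q + ·)
  let c₁ : List ℚ := List.replicate q 0 ++ List.replicate p 1
  let P₁ := loop (q + p) (q + p) fuel ⟨rows₁, initObj c₁ rows₁ basis₁, basis₁⟩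
  if P₁.2 ≠ 0 then ⟨.failed, [], 0⟩
  else if P₁.1.obj.getD (q + p) 0 ≠ 0 then ⟨.infeasible, [], 0⟩
  else
    -- phase 2 on the original columns
    let T₂ := driveOut q (2 * p + 1) 0 P₁.1
    let rows₂ := T₂.rows.map fun row => row.take q ++ [row.getD (q + p) 0]
    let P₂ := loop q q fuel ⟨rows₂, initObj c rows₂ T₂.basis, T₂.basis⟩
    if P₂.2 = 0 then ⟨.optimal, basicPoint q q P₂.1.rows P₂.1.basis, -(P₂.1.obj.getD q 0)⟩
    else if P₂.2 = 1 then ⟨.unbounded, [], 0⟩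
    else ⟨.failed, [], 0⟩

/-- The optimal value of a `Result`, if any. [folklore] -/
def Result.value? (res : Result) : Option ℚ :=
  if res.status = .optimal then some res.value else none

end Simplex

/-! ### Generators for the four certificate shapes of `LinearProgramming.lean` -/

/-- The columns of `A` as lists (= the rows of the dual constraint matrix `Aᵀ`). [folklore] -/
def colsOf (A : Matrix (Fin m) (Fin n) ℚ) : List (List ℚ) :=
  List.ofFn fun j : Fin n => List.ofFn fun i : Fin m => A i j

/-- **Optimal dual multipliers** for `c·x ≤ ?` over `{x | A x ≤ b}`, as a LIST (the `#eval` entry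
point: the printed list is the certificate literal for `vecOfList m […]`): an optimal basic
solution of `min {b·y : Aᵀ y = c, y ≥ 0}` by the exact simplex (empty if that LP is not solved
to optimality). [cite: BlekhermanParriloThomas2012, §2.1.1] -/
def ineqDualList (A : Matrix (Fin m) (Fin n) ℚ) (b : Fin m → ℚ) (c : Fin n → ℚ) (fuel : ℕ) :
    List ℚ :=
  (Simplex.solve (colsOf A) (List.ofFn c) (List.ofFn b) fuel).point

/-- The same as a `Fin m`-vector (the form the kernel predicates use; do not `#eval` this one —
printing a function re-runs the solver at every index — `#eval` `ineqDualList`).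
[cite: BlekhermanParriloThomas2012, §2.1.1] -/
def ineqDual (A : Matrix (Fin m) (Fin n) ℚ) (b : Fin m → ℚ) (c : Fin n → ℚ) (fuel : ℕ) :
    Fin m → ℚ :=
  vecOfList m (ineqDualList A b c fuel)

/-- The LP optimum `min {b·y : Aᵀ y = c, y ≥ 0}` (`= max {c·x : A x ≤ b}` when finite): the best
`δ` that `SelfIneqCert` can certify; `#eval` it. [folklore] -/
def ineqValue (A : Matrix (Fin m) (Fin n) ℚ) (b : Fin m → ℚ) (c : Fin n → ℚ) (fuel : ℕ) :
    Option ℚ :=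
  (Simplex.solve (colsOf A) (List.ofFn c) (List.ofFn b) fuel).value?

/-- Raw simplex point `y ++ z⁺ ++ z⁻` of `min {b·y + f·(z⁺ − z⁻) : Aᵀ y + Eᵀ (z⁺ − z⁻) = c,
y, z⁺, z⁻ ≥ 0}` (the `#eval` entry point of the general form). [cite: BlekhermanParriloThomas2012, §2.1.1] -/
def dualPointList (A : Matrix (Fin m) (Fin n) ℚ) (b : Fin m → ℚ) (E : Matrix (Fin p) (Fin n) ℚ)
    (f : Fin p → ℚ) (c : Fin n → ℚ) (fuel : ℕ) : List ℚ :=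
  let M := List.ofFn fun j : Fin n =>
    (List.ofFn fun i : Fin m => A i j) ++ (List.ofFn fun k : Fin p => E k j) ++
      List.ofFn fun k : Fin p => -E k j
  let cost := List.ofFn b ++ List.ofFn f ++ List.ofFn fun k => -f k
  (Simplex.solve M (List.ofFn c) cost fuel).point

/-- `(y, z)` as lists, `z = z⁺ − z⁻` (for `#eval`: the literals for `vecOfList m […]`,
`vecOfList p […]`). [folklore] -/
def dualPairLists (A : Matrix (Fin m) (Fin n) ℚ) (b : Fin m → ℚ) (E : Matrix (Fin p) (Fin n) ℚ)
    (f : Fin p → ℚ) (c : Fin n → ℚ) (fuel : ℕ) : List ℚ × List ℚ :=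
  let pt := dualPointList A b E f c fuel
  (pt.take m, (List.range p).map fun k => pt.getD (m + k) 0 - pt.getD (m + p + k) 0)

/-- **Optimal dual multipliers with equality rows**: `(y, z)` optimal for
`min {b·y + f·z : Aᵀ y + Eᵀ z = c, y ≥ 0}` (`z` free), as `Fin`-vectors (kernel form).
[cite: BlekhermanParriloThomas2012, §2.1.1] -/
def dualPair (A : Matrix (Fin m) (Fin n) ℚ) (b : Fin m → ℚ) (E : Matrix (Fin p) (Fin n) ℚ)
    (f : Fin p → ℚ) (c : Fin n → ℚ) (fuel : ℕ) : (Fin m → ℚ) × (Fin p → ℚ) :=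
  (vecOfList m (dualPairLists A b E f c fuel).1, vecOfList p (dualPairLists A b E f c fuel).2)

/-- The corresponding optimum (`#eval` it). [folklore] -/
def dualValue (A : Matrix (Fin m) (Fin n) ℚ) (b : Fin m → ℚ) (E : Matrix (Fin p) (Fin n) ℚ)
    (f : Fin p → ℚ) (c : Fin n → ℚ) (fuel : ℕ) : Option ℚ :=
  let M := List.ofFn fun j : Fin n =>
    (List.ofFn fun i : Fin m => A i j) ++ (List.ofFn fun k : Fin p => E k j) ++
      List.ofFn fun k : Fin p => -E k j
  let cost := List.ofFn b ++ List.ofFn f ++ List.ofFn fun k => -f k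
  (Simplex.solve M (List.ofFn c) cost fuel).value?

/-- **Optimal standard-form dual point** as a LIST (`#eval` entry point): `y` optimal for
`min {b·y : Aᵀ y ≥ c, y ≥ 0}` (surplus variables `s ≥ 0`, `Aᵀy − s = c`; the list is `y ++ s`
truncated to `y`). [cite: BlekhermanParriloThomas2012, §2.1.1] -/
def stdDualList (A : Matrix (Fin m) (Fin n) ℚ) (b : Fin m → ℚ) (c : Fin n → ℚ) (fuel : ℕ) :
    List ℚ :=
  let M := List.ofFn fun j : Fin n =>
    (List.ofFn fun i : Fin m => A i j) ++ List.ofFn fun k : Fin n => if k = j then (-1 : ℚ) else 0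
  let cost := List.ofFn b ++ List.ofFn fun _ : Fin n => (0 : ℚ)
  ((Simplex.solve M (List.ofFn c) cost fuel).point).take m

/-- The same as a `Fin m`-vector (kernel form). [cite: BlekhermanParriloThomas2012, §2.1.1] -/
def stdDual (A : Matrix (Fin m) (Fin n) ℚ) (b : Fin m → ℚ) (c : Fin n → ℚ) (fuel : ℕ) :
    Fin m → ℚ :=
  vecOfList m (stdDualList A b c fuel)

/-- The corresponding optimum (`#eval` it). [folklore] -/
def stdValue (A : Matrix (Fin m) (Fin n) ℚ) (b : Fin m → ℚ) (c : Fin n → ℚ) (fuel : ℕ) :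
    Option ℚ :=
  let M := List.ofFn fun j : Fin n =>
    (List.ofFn fun i : Fin m => A i j) ++ List.ofFn fun k : Fin n => if k = j then (-1 : ℚ) else 0
  let cost := List.ofFn b ++ List.ofFn fun _ : Fin n => (0 : ℚ)
  (Simplex.solve M (List.ofFn c) cost fuel).value?

/-- **Farkas search**, raw point `y ++ z⁺ ++ z⁻` (`#eval` entry point): the minimiser of
`b·y + f·(z⁺ − z⁻)` over `yᵀA + (z⁺ − z⁻)ᵀE = 0`, `y, z⁺, z⁻ ≥ 0`, `∑ y + ∑ z⁺ + ∑ z⁻ = 1`; it yields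
a Farkas certificate exactly when `{A x ≤ b, E x = f}` is infeasible (the optimum is then
negative). [cite: BlekhermanParriloThomas2012, §2.1.1] -/
def farkasPointList (A : Matrix (Fin m) (Fin n) ℚ) (b : Fin m → ℚ) (E : Matrix (Fin p) (Fin n) ℚ)
    (f : Fin p → ℚ) (fuel : ℕ) : List ℚ :=
  let M := (List.ofFn fun j : Fin n =>
      (List.ofFn fun i : Fin m => A i j) ++ (List.ofFn fun k : Fin p => E k j) ++
        List.ofFn fun k : Fin p => -E k j) ++
    [List.replicate (m + p + p) (1 : ℚ)]
  let rhs := (List.ofFn fun _ : Fin n => (0 : ℚ)) ++ [1]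
  let cost := List.ofFn b ++ List.ofFn f ++ List.ofFn fun k => -f k
  (Simplex.solve M rhs cost fuel).point

/-- `(y, z)` of the Farkas search as lists, `z = z⁺ − z⁻` (for `#eval`). [folklore] -/
def farkasPairLists (A : Matrix (Fin m) (Fin n) ℚ) (b : Fin m → ℚ) (E : Matrix (Fin p) (Fin n) ℚ)
    (f : Fin p → ℚ) (fuel : ℕ) : List ℚ × List ℚ :=
  let pt := farkasPointList A b E f fuel
  (pt.take m, (List.range p).map fun k => pt.getD (m + k) 0 - pt.getD (m + p + k) 0)

/-- The Farkas search result `(y, z)` as `Fin`-vectors (kernel form).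
[cite: BlekhermanParriloThomas2012, §2.1.1] -/
def farkasPair (A : Matrix (Fin m) (Fin n) ℚ) (b : Fin m → ℚ) (E : Matrix (Fin p) (Fin n) ℚ)
    (f : Fin p → ℚ) (fuel : ℕ) : (Fin m → ℚ) × (Fin p → ℚ) :=
  (vecOfList m (farkasPairLists A b E f fuel).1, vecOfList p (farkasPairLists A b E f fuel).2)

/-! ### Trusted predicates (= the gen-1 predicates on the computed multipliers) and soundness -/

/-- **Self-certificate, inequality form**: the simplex multipliers certify `c·x ≤ δ` on
`{x | A x ≤ b}`. Decidable; close it by `decide +kernel`.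
[cite: BlekhermanParriloThomas2012, §2.1.1] -/
def SelfIneqCert (A : Matrix (Fin m) (Fin n) ℚ) (b : Fin m → ℚ) (c : Fin n → ℚ) (δ : ℚ)
    (fuel : ℕ) : Prop :=
  IsIneqCert A b c δ (ineqDual A b c fuel)

/-- Decidability of `SelfIneqCert`. [folklore] -/
instance SelfIneqCert.instDecidable (A : Matrix (Fin m) (Fin n) ℚ) (b : Fin m → ℚ)
    (c : Fin n → ℚ) (δ : ℚ) (fuel : ℕ) : Decidable (SelfIneqCert A b c δ fuel) :=
  inferInstanceAs (Decidable (IsIneqCert A b c δ (ineqDual A b c fuel)))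

namespace SelfIneqCert

variable {A : Matrix (Fin m) (Fin n) ℚ} {b : Fin m → ℚ} {c : Fin n → ℚ} {δ : ℚ} {fuel : ℕ}

/-- The underlying certificate. [folklore] -/
theorem isIneqCert (h : SelfIneqCert A b c δ fuel) : IsIneqCert A b c δ (ineqDual A b c fuel) := h

/-- **Soundness**: `A x ≤ b ⇒ c·x ≤ δ` over any linearly ordered field (e.g. `ℝ`).
[cite: BlekhermanParriloThomas2012, §2.1.1] -/
theorem sound (h : SelfIneqCert A b c δ fuel) (x : Fin n → R)
    (hA : ∀ i, ∑ j, (A i j : R) * x j ≤ b i) : ∑ j, (c j : R) * x j ≤ δ :=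
  h.isIneqCert.sound x hA

/-- Strict version: a self-certificate for `δ'` and `δ' < δ` give `c·x < δ`. [folklore] -/
theorem sound_lt (h : SelfIneqCert A b c δ fuel) {δ₁ : ℚ} (hδ : δ < δ₁) (x : Fin n → R)
    (hA : ∀ i, ∑ j, (A i j : R) * x j ≤ b i) : ∑ j, (c j : R) * x j < δ₁ :=
  h.isIneqCert.sound_lt hδ x hA

end SelfIneqCert

/-- **Self-certificate, general form** (`A x ≤ b`, `E x = f`). Decidable; `decide +kernel`.
[cite: BlekhermanParriloThomas2012, §2.1.1] -/
def SelfDualCert (A : Matrix (Fin m) (Fin n) ℚ) (b : Fin m → ℚ) (E : Matrix (Fin p) (Fin n) ℚ)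
    (f : Fin p → ℚ) (c : Fin n → ℚ) (δ : ℚ) (fuel : ℕ) : Prop :=
  IsDualCert A b E f c δ (dualPair A b E f c fuel).1 (dualPair A b E f c fuel).2

/-- Decidability of `SelfDualCert`. [folklore] -/
instance SelfDualCert.instDecidable (A : Matrix (Fin m) (Fin n) ℚ) (b : Fin m → ℚ)
    (E : Matrix (Fin p) (Fin n) ℚ) (f : Fin p → ℚ) (c : Fin n → ℚ) (δ : ℚ) (fuel : ℕ) :
    Decidable (SelfDualCert A b E f c δ fuel) :=
  inferInstanceAs (Decidable
    (IsDualCert A b E f c δ (dualPair A b E f c fuel).1 (dualPair A b E f c fuel).2))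

namespace SelfDualCert

variable {A : Matrix (Fin m) (Fin n) ℚ} {b : Fin m → ℚ} {E : Matrix (Fin p) (Fin n) ℚ}
  {f : Fin p → ℚ} {c : Fin n → ℚ} {δ : ℚ} {fuel : ℕ}

/-- The underlying certificate. [folklore] -/
theorem isDualCert (h : SelfDualCert A b E f c δ fuel) :
    IsDualCert A b E f c δ (dualPair A b E f c fuel).1 (dualPair A b E f c fuel).2 := h

/-- **Soundness**: `A x ≤ b`, `E x = f` ⇒ `c·x ≤ δ`. [cite: BlekhermanParriloThomas2012, §2.1.1] -/
theorem sound (h : SelfDualCert A b E f c δ fuel) (x : Fin n → R)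
    (hA : ∀ i, ∑ j, (A i j : R) * x j ≤ b i) (hE : ∀ i, ∑ j, (E i j : R) * x j = f i) :
    ∑ j, (c j : R) * x j ≤ δ :=
  h.isDualCert.sound x hA hE

/-- Strict version. [folklore] -/
theorem sound_lt (h : SelfDualCert A b E f c δ fuel) {δ₁ : ℚ} (hδ : δ < δ₁) (x : Fin n → R)
    (hA : ∀ i, ∑ j, (A i j : R) * x j ≤ b i) (hE : ∀ i, ∑ j, (E i j : R) * x j = f i) :
    ∑ j, (c j : R) * x j < δ₁ :=
  h.isDualCert.sound_lt hδ x hA hE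

end SelfDualCert

/-- **Self-certificate, standard form** (`x ≥ 0`, `A x ≤ b`): the simplex point is dual feasible
and its value `b·y` is at most `δ`. Decidable; `decide +kernel`.
[cite: BlekhermanParriloThomas2012, §2.1.1] -/
def SelfStdCert (A : Matrix (Fin m) (Fin n) ℚ) (b : Fin m → ℚ) (c : Fin n → ℚ) (δ : ℚ)
    (fuel : ℕ) : Prop :=
  IsStdDualCert A c (stdDual A b c fuel) ∧ ∑ i, stdDual A b c fuel i * b i ≤ δ

/-- Decidability of `SelfStdCert`. [folklore] -/
instance SelfStdCert.instDecidable (A : Matrix (Fin m) (Fin n) ℚ) (b : Fin m → ℚ)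
    (c : Fin n → ℚ) (δ : ℚ) (fuel : ℕ) : Decidable (SelfStdCert A b c δ fuel) :=
  inferInstanceAs (Decidable
    (IsStdDualCert A c (stdDual A b c fuel) ∧ ∑ i, stdDual A b c fuel i * b i ≤ δ))

namespace SelfStdCert

variable {A : Matrix (Fin m) (Fin n) ℚ} {b : Fin m → ℚ} {c : Fin n → ℚ} {δ : ℚ} {fuel : ℕ}

/-- **Soundness**: `x ≥ 0`, `A x ≤ b` ⇒ `c·x ≤ δ`. [cite: BlekhermanParriloThomas2012, §2.1.1] -/
theorem sound (h : SelfStdCert A b c δ fuel) (x : Fin n → R) (hx : ∀ j, 0 ≤ x j)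
    (hA : ∀ i, ∑ j, (A i j : R) * x j ≤ b i) : ∑ j, (c j : R) * x j ≤ δ :=
  (h.1.sound b x hx hA).trans (by exact_mod_cast h.2)

end SelfStdCert

/-- **Self-certificate of infeasibility**: the Farkas search result is a Farkas certificate for
`{A x ≤ b, E x = f}`. Decidable; `decide +kernel`. [cite: BlekhermanParriloThomas2012, §2.1.1] -/
def SelfFarkasCert (A : Matrix (Fin m) (Fin n) ℚ) (b : Fin m → ℚ) (E : Matrix (Fin p) (Fin n) ℚ)
    (f : Fin p → ℚ) (fuel : ℕ) : Prop :=
  IsFarkasCert A b E f (farkasPair A b E f fuel).1 (farkasPair A b E f fuel).2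

/-- Decidability of `SelfFarkasCert`. [folklore] -/
instance SelfFarkasCert.instDecidable (A : Matrix (Fin m) (Fin n) ℚ) (b : Fin m → ℚ)
    (E : Matrix (Fin p) (Fin n) ℚ) (f : Fin p → ℚ) (fuel : ℕ) :
    Decidable (SelfFarkasCert A b E f fuel) :=
  inferInstanceAs (Decidable
    (IsFarkasCert A b E f (farkasPair A b E f fuel).1 (farkasPair A b E f fuel).2))

namespace SelfFarkasCert

variable {A : Matrix (Fin m) (Fin n) ℚ} {b : Fin m → ℚ} {E : Matrix (Fin p) (Fin n) ℚ}
  {f : Fin p → ℚ} {fuel : ℕ}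

/-- The underlying certificate. [folklore] -/
theorem isFarkasCert (h : SelfFarkasCert A b E f fuel) :
    IsFarkasCert A b E f (farkasPair A b E f fuel).1 (farkasPair A b E f fuel).2 := h

/-- **Soundness**: no point over any linearly ordered field satisfies `A x ≤ b`, `E x = f`.
[cite: BlekhermanParriloThomas2012, §2.1.1] -/
theorem infeasible (h : SelfFarkasCert A b E f fuel) (x : Fin n → R)
    (hA : ∀ i, ∑ j, (A i j : R) * x j ≤ b i) (hE : ∀ i, ∑ j, (E i j : R) * x j = f i) : False :=
  h.isFarkasCert.infeasible x hA hE

end SelfFarkasCert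

/-! ### Tests / usage templates (kernel-checked; no multipliers anywhere below) -/

/-- Test (= the first test of `LinearProgramming.lean`, now without a certificate): on
`x₀ + x₁ ≤ 4`, `-x₀ ≤ 0`, `-x₁ ≤ 0`, `x₀ - x₁ ≤ 1` the objective `2x₀ + x₁` is at most `13/2`. -/
example (x : Fin 2 → ℝ)
    (hA : ∀ i, ∑ j, ((!![1, 1; -1, 0; 0, -1; 1, -1] : Matrix (Fin 4) (Fin 2) ℚ) i j : ℝ) * x j ≤
      ((![4, 0, 0, 1] : Fin 4 → ℚ) i : ℝ)) :
    ∑ j, ((![2, 1] : Fin 2 → ℚ) j : ℝ) * x j ≤ ((13 / 2 : ℚ) : ℝ) :=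
  SelfIneqCert.sound (fuel := 100) (by decide +kernel) x hA

/-- Test: … `13/2` IS the LP optimum (the value query, as a kernel-decided equation; in practice
one runs `#eval LP.ineqValue A b c 100`). -/
example : ineqValue (!![1, 1; -1, 0; 0, -1; 1, -1] : Matrix (Fin 4) (Fin 2) ℚ) ![4, 0, 0, 1] ![2, 1]
    100 = some (13 / 2) := by
  decide +kernel

/-- Test: … so the bound `6 < 13/2` is rejected by the kernel (stated positively: the
self-certificate predicate is `False` for `δ = 6`). -/
example : ¬ SelfIneqCert (!![1, 1; -1, 0; 0, -1; 1, -1] : Matrix (Fin 4) (Fin 2) ℚ) ![4, 0, 0, 1]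
    ![2, 1] 6 100 := by
  decide +kernel

/-- Test (general form, strict conclusion, over `ℚ`): `x₀ + x₁ + x₂ = 1`, `x ≥ 0` ⇒ `x₀ - x₂ < 2`
(the simplex proves the optimum `1`). -/
example (x : Fin 3 → ℚ)
    (hA : ∀ i, ∑ j, ((!![-1, 0, 0; 0, -1, 0; 0, 0, -1] : Matrix (Fin 3) (Fin 3) ℚ) i j : ℚ) * x j
      ≤ ((![0, 0, 0] : Fin 3 → ℚ) i : ℚ))
    (hE : ∀ i, ∑ j, ((!![1, 1, 1] : Matrix (Fin 1) (Fin 3) ℚ) i j : ℚ) * x j =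
      ((![1] : Fin 1 → ℚ) i : ℚ)) :
    ∑ j, ((![1, 0, -1] : Fin 3 → ℚ) j : ℚ) * x j < ((2 : ℚ) : ℚ) :=
  SelfDualCert.sound_lt (δ := 1) (fuel := 100) (by decide +kernel) (by norm_num) x hA hE

/-- Test (standard form): `x ≥ 0`, `x₀ + 2x₁ ≤ 4`, `3x₀ + x₁ ≤ 6` ⇒ `x₀ + x₁ ≤ 14/5`. -/
example (x : Fin 2 → ℝ) (hx : ∀ j, 0 ≤ x j)
    (hA : ∀ i, ∑ j, ((!![1, 2; 3, 1] : Matrix (Fin 2) (Fin 2) ℚ) i j : ℝ) * x j ≤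
      ((![4, 6] : Fin 2 → ℚ) i : ℝ)) :
    ∑ j, ((![1, 1] : Fin 2 → ℚ) j : ℝ) * x j ≤ ((14 / 5 : ℚ) : ℝ) :=
  SelfStdCert.sound (b := ![4, 6]) (fuel := 100) (by decide +kernel) x hx hA

/-- Test (Farkas): `x₀ ≤ 0`, `-x₀ ≤ -1` is infeasible, found by the kernel. -/
example (x : Fin 1 → ℝ)
    (hA : ∀ i, ∑ j, ((!![1; -1] : Matrix (Fin 2) (Fin 1) ℚ) i j : ℝ) * x j ≤
      ((![0, -1] : Fin 2 → ℚ) i : ℝ)) : False :=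
  SelfFarkasCert.infeasible (E := (Matrix.of ![] : Matrix (Fin 0) (Fin 1) ℚ)) (f := ![])
    (fuel := 100) (by decide +kernel) x hA (fun i => i.elim0)

/-- Test (degenerate vertex and a redundant row): the unit square `0 ≤ x₀, x₁ ≤ 1` with the
redundant extra row `x₀ + x₁ ≤ 2`; `x₀ + x₁ ≤ 2` is certified (optimum `2`, degenerate). -/
example (x : Fin 2 → ℝ)
    (hA : ∀ i, ∑ j, ((!![1, 0; 0, 1; -1, 0; 0, -1; 1, 1] : Matrix (Fin 5) (Fin 2) ℚ) i j : ℝ) * x j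
      ≤ ((![1, 1, 0, 0, 2] : Fin 5 → ℚ) i : ℝ)) :
    ∑ j, ((![1, 1] : Fin 2 → ℚ) j : ℝ) * x j ≤ ((2 : ℚ) : ℝ) :=
  SelfIneqCert.sound (fuel := 100) (by decide +kernel) x hA

/-- Test (the raw solver on lists, the `#eval` entry point; here decided by the kernel): the
transportation-type LP `min {y₀ + 2y₁ + 3y₂ : y₀ + y₁ = 1, y₁ + y₂ = 1, y ≥ 0}` has optimum `2` at
`y = (0, 1, 0)`. -/
example : (Simplex.solve [[1, 1, 0], [0, 1, 1]] [1, 1] [1, 2, 3] 50).point = [0, 1, 0] ∧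
    (Simplex.solve [[1, 1, 0], [0, 1, 1]] [1, 1] [1, 2, 3] 50).value = 2 := by
  decide +kernel

/-- Test (infeasible and unbounded instances are reported, not certified). -/
example : (Simplex.solve [[1, 1]] [-1] [1, 1] 50).status = .infeasible ∧
    (Simplex.solve [[1, -1]] [0] [-1, -1] 50).status = .unbounded := by
  decide +kernel

end LP

end Literature.Computation.Certificates
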